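/-
Copyright (c) 2026 the pub-hodgecm-mathlib formalisation cell (harness21).  Prover seat hodgecm-mathlib-K2E3-p21 (g4), Track B «K2-LIT» ∕ h413
(`stmt-HodgeConjecture-24833`), line `K2_E3_EllipticInputs`, road «FC-GL» (finite conjugation measure on `GL₃(F) ⧸ Z`, line lead K2E3-p23 (g4), RULINGS #1 (G1-1)
2026-09-04T04:53Z), brick (GL-D2) «QUADRATIC SUBLEVEL = TWO BALLS».  2026-09-04.
-/
import Summits.HodgeConjecture.HodgeConjecture.Theorems.K2E3UnitsDigitFibre   -- ★ FC-D p857254 (this seat): `unitsDigitFibre` (additive + norm digit-count fibre bounds)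
import HarnessLib

/-!
# Crux `H413` — K2-LIT E3, road «FC-GL», brick (GL-D2): THE QUADRATIC DIGIT-COUNT FIBRE BOUND ON THE UNIT GROUP
# `λ×{a ∈ 𝒪ˣ : |p(a·x)| ≤ r} ≤ C r^κ λ×(𝒪ˣ)` for every monic quadratic `p(u) = u² + c u + e`, `|x| = 1`

Cell `hodgecm-mathlib`, Track B, line `K2_E3_EllipticInputs`, road «FC-GL» of K2E3-p23 (g4) (CENSUS `CENSUS-SD-GL3Supercuspidal` (3), RULINGS #1 (G1-1)): the fibre bound
that (GL-5) sums when the isolated diagonal entry `h₀₀` of a near-block-triangular `h ∈ GL₃(F)` is averaged over `diag(u, 1, 1)` against the complementary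
`2 × 2` block's characteristic polynomial.  THEOREMS ONLY; count-neutral helper (`--supports stmt-HodgeConjecture-24833 --as helper`); σ-free.

THE MATHEMATICS (elementary, no field extension).  `K` a non-archimedean local field of characteristic `0`, `|·| = normAbs K`, `μ'` a Haar measure on `Kˣ`.
* §1 **TWO BALLS**: for a monic quadratic `p(u) = u² + c u + e` and any `u₀` with `|p(u₀)| ≤ r`, `{u : |p(u)| ≤ r} ⊆ B(u₀, √r) ∪ B(−u₀ − c, √r)` — because
  `p(u) − p(u₀) = (u − u₀)(u + u₀ + c)` has absolute value `≤ r` (ultrametric), so one factor is `≤ √r`.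
* §2 **THE HEAD** `unitsQuadraticFibre`: `∃ κ > 0, C < ∞, ∀ r x c e, |x| = 1 → μ'{a ∈ 𝒪ˣ : |p(a x)| ≤ r} ≤ C r^κ μ'(𝒪ˣ)` — the event is empty or, by §1 with
  `u₀ = a₀ x`, inside the union of the two ADDITIVE events `|a x − u₀| ≤ √r`, `|a x − (−u₀ − c)| ≤ √r` of ★ FC-D `K2E3UnitsDigitFibre.unitsDigitFibre` (at
  `σ := RingHom.id K`); for `√r ≤ 1` each costs `C_D (√r)^{κ_D} μ'(𝒪ˣ)`, for `r > 1` the trivial bound `μ'(𝒪ˣ)` is absorbed by `C ≥ 1`: `κ = κ_D ∕ 2`,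
  `C = max (2 C_D) 1`.

HONEST LABEL: HC_CM is proved only modulo the 7 printed citations (2 remaining named inputs: hLiu418 = stmt-HodgeConjecture-24832, h413 =
stmt-HodgeConjecture-24833) until rung 0 closes; elementary, closes no organ by itself (road «FC-GL» is the (S-D) supercuspidal-`GL₃` input of row 11).

## References
* [Serre1979] J.-P. Serre, *Local Fields*, GTM 67 (1979), Ch. II §3, Ch. IV §2 (ultrametric balls; the unit filtration).
* [Folland1995] G. B. Folland, *A Course in Abstract Harmonic Analysis* (1995), §2.2 (invariance of Haar measure).
-/

set_option autoImplicit false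
-- the mandated namespace repeats `HodgeConjecture.HodgeConjecture`, as in every `Theorems/*.lean` of this sub-problem
set_option linter.dupNamespace false

noncomputable section

open MeasureTheory MeasureTheory.Measure Set Function
open scoped NNReal ENNReal Pointwise Valued
open ValuativeRel
open Literature.NumberTheory.GaloisRepresentations Literature.NumberTheory.GaloisRepresentations.IsNonarchimedeanLocalField
open Literature.NumberTheory.Automorphic Literature.NumberTheory.Automorphic.LocalFieldHaar
open Summit.HodgeConjecture.HodgeConjecture.Cruxes.H413.K2E3UnitsDigitFibre

namespace Summit.HodgeConjecture.HodgeConjecture.Cruxes.H413.K2E3UnitsQuadraticFibre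

variable {K : Type*} [Field K] [ValuativeRel K] [TopologicalSpace K] [IsNonarchimedeanLocalField K]

/-! ## §1  Two balls -/

/-- `|p(u) − p(u₀)| ≤ r` when `|p(u)|, |p(u₀)| ≤ r` (ultrametric inequality). [folklore] -/
theorem normAbs_sub_le_of_le {y y₀ : K} {r : ℝ≥0} (hy : normAbs K y ≤ r) (hy₀ : normAbs K y₀ ≤ r) : normAbs K (y - y₀) ≤ r := by
  rw [sub_eq_add_neg]
  exact (normAbs_add_le_max _ _).trans (max_le hy (by rwa [normAbs_neg]))

/-- **TWO BALLS.**  For a monic quadratic `p(u) = u² + c u + e` and `u₀` with `|p(u₀)| ≤ r`: `{u : |p(u)| ≤ r} ⊆ B(u₀, √r) ∪ B(−u₀ − c, √r)`, since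
`p(u) − p(u₀) = (u − u₀)(u + u₀ + c)` has absolute value `≤ r`, so one of the two factors has absolute value `≤ √r`. [cite: Serre1979, Ch. II §3] -/
theorem quadratic_sublevel_subset (c e u₀ : K) (r : ℝ≥0) (h₀ : normAbs K (u₀^2 + c*u₀ + e) ≤ r) : {u | normAbs K (u^2 + c*u + e) ≤ r} ⊆ {u | normAbs K (u - u₀) ≤ NNReal.sqrt r} ∪ {u | normAbs K (u + u₀ + c) ≤ NNReal.sqrt r} := by
  intro u hu
  rw [Set.mem_setOf_eq] at hu
  have hprod : normAbs K (u - u₀) * normAbs K (u + u₀ + c) ≤ r := by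
    rw [← map_mul]
    have hfac : (u - u₀) * (u + u₀ + c) = (u ^ 2 + c * u + e) - (u₀ ^ 2 + c * u₀ + e) := by ring
    rw [hfac]
    exact normAbs_sub_le_of_le hu h₀
  by_contra h
  rw [Set.mem_union, Set.mem_setOf_eq, Set.mem_setOf_eq, not_or, not_le, not_le] at h
  have hlt : NNReal.sqrt r * NNReal.sqrt r < normAbs K (u - u₀) * normAbs K (u + u₀ + c) := mul_lt_mul'' h.1 h.2 zero_le zero_le
  rw [NNReal.mul_self_sqrt] at hlt
  exact absurd hprod (not_le.2 hlt)

/-! ## §2  The head -/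

/-- `(√r)^κ = r^(κ∕2)` in `ℝ≥0∞` (for `0 ≤ κ`). [folklore] -/
theorem coe_sqrt_rpow (r : ℝ≥0) {κ : ℝ} (hκ : 0 ≤ κ) : ((NNReal.sqrt r : ℝ≥0) : ℝ≥0∞) ^ κ = (r : ℝ≥0∞) ^ (κ / 2) := by
  rw [← ENNReal.coe_rpow_of_nonneg _ hκ, ← ENNReal.coe_rpow_of_nonneg _ (by positivity), NNReal.sqrt_eq_rpow, ← NNReal.rpow_mul]
  congr 2
  ring

/-- **(GL-D2) THE QUADRATIC DIGIT-COUNT FIBRE BOUND ON `𝒪_K^×`** (head frozen by K2E3-p23 (g4), RULINGS #1 (G1-1)).  For a non-archimedean local field `K` of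
characteristic `0` and a Haar measure `μ'` on `Kˣ` there are `κ > 0` and `C < ∞` with, for ALL `r` and all `x, c, e` with `|x| = 1`,
`μ'{a ∈ 𝒪ˣ : |(a x)² + c (a x) + e| ≤ r} ≤ C r^κ μ'(𝒪ˣ)`.  Proof: §1 puts the event inside two additive events of ★ FC-D at radius `√r` (`σ := id`);
`κ = κ_D ∕ 2`, `C = max (2 C_D) 1` (the `1` clamps `r > 1`). [cite: Serre1979, Ch. IV §2] [cite: Folland1995, §2.2] -/
theorem unitsQuadraticFibre [CharZero K] [MeasurableSpace Kˣ] [BorelSpace Kˣ] (μ' : Measure Kˣ) [μ'.IsHaarMeasure] : ∃ κ : ℝ, 0 < κ ∧ ∃ C : ℝ≥0∞, C ≠ ⊤ ∧ ∀ r : ℝ≥0, ∀ x c e : K, normAbs K x = 1 → μ' {a : Kˣ | valuation K ↑a = 1 ∧ normAbs K ((↑a * x)^2 + c * (↑a * x) + e) ≤ r} ≤ C * (r : ℝ≥0∞) ^ κ * μ' {a : Kˣ | valuation K ↑a = 1} := by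
  obtain ⟨κ, hκ, C, hC, hD⟩ := unitsDigitFibre (RingHom.id K) (fun _ => rfl) (fun _ => rfl) μ'
  refine ⟨κ / 2, half_pos hκ, max (2 * C) 1, ?_, fun r x c e hx => ?_⟩
  · exact ne_top_of_le_ne_top (by simpa using ENNReal.add_ne_top.2 ⟨ENNReal.mul_ne_top ENNReal.ofNat_ne_top hC, ENNReal.one_ne_top⟩) (max_le_add_of_nonneg zero_le zero_le)
  rcases le_or_gt (NNReal.sqrt r) 1 with hr | hr
  · -- `√r ≤ 1`: two additive events at radius `√r`
    rcases Set.eq_empty_or_nonempty {a : Kˣ | valuation K ↑a = 1 ∧ normAbs K ((↑a * x)^2 + c * (↑a * x) + e) ≤ r} with h0 | ⟨a₀, ha₀1, ha₀⟩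
    · rw [h0, measure_empty]
      exact zero_le
    · have hsub : {a : Kˣ | valuation K ↑a = 1 ∧ normAbs K ((↑a * x)^2 + c * (↑a * x) + e) ≤ r} ⊆
          {a : Kˣ | valuation K ↑a = 1 ∧ normAbs K (↑a * x - ↑a₀ * x) ≤ NNReal.sqrt r} ∪
            {a : Kˣ | valuation K ↑a = 1 ∧ normAbs K (↑a * x - (-(↑a₀ * x) - c)) ≤ NNReal.sqrt r} := by
        rintro a ⟨ha1, ha⟩
        rcases quadratic_sublevel_subset c e ((a₀ : K) * x) r ha₀ ha with h | h
        · exact Or.inl ⟨ha1, h⟩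
        · refine Or.inr ⟨ha1, ?_⟩
          rw [Set.mem_setOf_eq] at h
          have he : (a : K) * x - (-((a₀ : K) * x) - c) = (a : K) * x + (a₀ : K) * x + c := by ring
          rwa [he]
      have h1 := ((hD (NNReal.sqrt r) hr x ((a₀ : K) * x) hx).1)
      have h2 := ((hD (NNReal.sqrt r) hr x (-((a₀ : K) * x) - c) hx).1)
      calc μ' {a : Kˣ | valuation K ↑a = 1 ∧ normAbs K ((↑a * x)^2 + c * (↑a * x) + e) ≤ r}
          ≤ μ' ({a : Kˣ | valuation K ↑a = 1 ∧ normAbs K (↑a * x - ↑a₀ * x) ≤ NNReal.sqrt r} ∪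
              {a : Kˣ | valuation K ↑a = 1 ∧ normAbs K (↑a * x - (-(↑a₀ * x) - c)) ≤ NNReal.sqrt r}) := measure_mono hsub
        _ ≤ μ' {a : Kˣ | valuation K ↑a = 1 ∧ normAbs K (↑a * x - ↑a₀ * x) ≤ NNReal.sqrt r} +
              μ' {a : Kˣ | valuation K ↑a = 1 ∧ normAbs K (↑a * x - (-(↑a₀ * x) - c)) ≤ NNReal.sqrt r} := measure_union_le _ _
        _ ≤ C * ((NNReal.sqrt r : ℝ≥0) : ℝ≥0∞) ^ κ * μ' {a : Kˣ | valuation K ↑a = 1} +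
              C * ((NNReal.sqrt r : ℝ≥0) : ℝ≥0∞) ^ κ * μ' {a : Kˣ | valuation K ↑a = 1} := add_le_add h1 h2
        _ = 2 * C * (r : ℝ≥0∞) ^ (κ / 2) * μ' {a : Kˣ | valuation K ↑a = 1} := by rw [coe_sqrt_rpow r hκ.le]; ring
        _ ≤ max (2 * C) 1 * (r : ℝ≥0∞) ^ (κ / 2) * μ' {a : Kˣ | valuation K ↑a = 1} := by gcongr; exact le_max_left _ _
  · -- `r > 1`: the trivial bound, absorbed by `C ≥ 1`
    have hr1 : (1 : ℝ≥0∞) ≤ (r : ℝ≥0∞) := by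
      have h1 : (1 : ℝ≥0) < r := by
        rw [← NNReal.sqrt_one] at hr
        exact NNReal.sqrt_lt_sqrt.1 hr
      exact_mod_cast h1.le
    calc μ' {a : Kˣ | valuation K ↑a = 1 ∧ normAbs K ((↑a * x)^2 + c * (↑a * x) + e) ≤ r}
        ≤ μ' {a : Kˣ | valuation K ↑a = 1} := measure_mono fun a ha => ha.1
      _ = 1 * 1 * μ' {a : Kˣ | valuation K ↑a = 1} := by rw [one_mul, one_mul]
      _ ≤ max (2 * C) 1 * (r : ℝ≥0∞) ^ (κ / 2) * μ' {a : Kˣ | valuation K ↑a = 1} :=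
          mul_le_mul' (mul_le_mul' (le_max_right _ _) (ENNReal.one_le_rpow hr1 (half_pos hκ))) le_rfl

end Summit.HodgeConjecture.HodgeConjecture.Cruxes.H413.K2E3UnitsQuadraticFibre

end
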